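import Mathlib
import HarnessLib
import Summits.NavierStokesRegularity.NavierStokesRegularity.Theorems.PoloidalWindowDoorLrcModEntireTubeChart
import Summits.NavierStokesRegularity.NavierStokesRegularity.Theorems.PoloidalWindowDoorLrcModEntireRidgeBranchCurvature

/-!
# Item `LrcModEntire` (stmt-NavierStokesRegularity-20428) — (Q3∞)/(Q4) input (U-TUBE): the FRAME MAP `Ψ(s,n,z) = γ s + n ν s + z e₂` IS OPEN AT EVERY POINT OF THE THIN TUBE

ns-k2-port-2 g5 (helper prover under the LEAD of item 20428, ns-poloidal-K2-p3 g14; `--supports stmt-NavierStokesRegularity-20428 --as helper`).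
The LEAD's entrance of cell (Q4), `…RidgeWebEntrance.fderiv_uncurry_eq_of_ridgeWeb` (Fermat at a web point of a homogeneous ridge), takes the openness of the planar frame map at the
web point as the hypothesis `𝓝 (Ψ q₀) ≤ map Ψ (𝓝 q₀)`.  Here it is supplied (class-free):

* `nhds_le_map_frame` — `γ, ν : ℝ → ℝ³` of class `C¹` with `γ₂ = ν₂ = 0`, and at `q₀ = (s₀, n₀, z₀)` the planar vectors `γ′(s₀) + n₀ν′(s₀)` and `ν(s₀)` have non-zero determinant
  ⇒ `Ψ` has an invertible strict derivative at `q₀` (third direction `e₂`), hence `map Ψ (𝓝 q₀) = 𝓝 (Ψ q₀)` (`HasStrictFDerivAt.map_nhds_eq_of_equiv`);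
* `nhds_le_map_frame_of_curvature` — for a `C²` branch of Euclidean unit speed with curvature `‖γ″‖ ≤ B` and its in-plane normal `ν = (−γ′₁, γ′₀, 0)`, the determinant is
  `1 − n₀·c(s₀)` (`|c| ≤ B`), so the conclusion holds at every `q₀` with `|n₀|·B < 1` — uniformly along a complete branch (the (U-TUBE) input of memo `T2B-g14.md` §13b).

WHAT THIS IS NOT: not a claim about Navier–Stokes regularity — differential bookkeeping for the entrance of the research cell (Q4) on hypothetical profiles (bears_on LADDER-NS N0, item 20428 /
crux 19708; 20428/19708/27893 OPEN).  No summit statement is proved here.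
-/

noncomputable section

-- the summit and its single sub-problem share the name (CONVENTIONS §1), as in every Theorems file
set_option linter.dupNamespace false

namespace Summit.NavierStokesRegularity.NavierStokesRegularity.Theorems.PoloidalWindowDoorLrcModEntireRidgeFrameOpen

open Set Filter Topology Function
open Summit.NavierStokesRegularity.NavierStokesRegularity.Theorems.PoloidalWindowDoorLrcModEntireTubeChart
open Summit.NavierStokesRegularity.NavierStokesRegularity.Theorems.PoloidalWindowDoorLrcModEntireRidgeBranchCurvature

variable {γ ν : ℝ → EuclideanSpace ℝ (Fin 3)}

/-- **The frame map is open at a point of non-degeneracy.**  See the module docstring. -/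
theorem nhds_le_map_frame (hγ1 : ContDiff ℝ 1 γ) (hν1 : ContDiff ℝ 1 ν) (hγ2 : ∀ s, γ s 2 = 0) (hν2 : ∀ s, ν s 2 = 0) (q₀ : ℝ × ℝ × ℝ)
    (hdet : (deriv γ q₀.1 0 + q₀.2.1 * deriv ν q₀.1 0) * ν q₀.1 1 - (deriv γ q₀.1 1 + q₀.2.1 * deriv ν q₀.1 1) * ν q₀.1 0 ≠ 0) :
    𝓝 (γ q₀.1 + q₀.2.1 • ν q₀.1 + q₀.2.2 • EuclideanSpace.single 2 (1 : ℝ)) ≤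
      map (fun q : ℝ × ℝ × ℝ => γ q.1 + q.2.1 • ν q.1 + q.2.2 • EuclideanSpace.single 2 (1 : ℝ)) (𝓝 q₀) := by
  set e₂ : EuclideanSpace ℝ (Fin 3) := EuclideanSpace.single 2 (1 : ℝ) with he₂
  set Ψ : ℝ × ℝ × ℝ → EuclideanSpace ℝ (Fin 3) := fun q => γ q.1 + q.2.1 • ν q.1 + q.2.2 • e₂ with hΨ
  have hγd : Differentiable ℝ γ := hγ1.differentiable one_ne_zero
  have hνd : Differentiable ℝ ν := hν1.differentiable one_ne_zero
  -- the derivative of `Ψ` at `q₀`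
  set F₁ : ℝ × ℝ × ℝ →L[ℝ] ℝ := ContinuousLinearMap.fst ℝ ℝ (ℝ × ℝ) with hF₁
  set F₂ : ℝ × ℝ × ℝ →L[ℝ] ℝ := (ContinuousLinearMap.fst ℝ ℝ ℝ).comp (ContinuousLinearMap.snd ℝ ℝ (ℝ × ℝ)) with hF₂
  set F₃ : ℝ × ℝ × ℝ →L[ℝ] ℝ := (ContinuousLinearMap.snd ℝ ℝ ℝ).comp (ContinuousLinearMap.snd ℝ ℝ (ℝ × ℝ)) with hF₃
  have hA : HasFDerivAt (fun q : ℝ × ℝ × ℝ => γ q.1) ((ContinuousLinearMap.smulRight (1 : ℝ →L[ℝ] ℝ) (deriv γ q₀.1)).comp F₁) q₀ :=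
    (hγd q₀.1).hasDerivAt.hasFDerivAt.comp q₀ hasFDerivAt_fst
  have hN : HasFDerivAt (fun q : ℝ × ℝ × ℝ => ν q.1) ((ContinuousLinearMap.smulRight (1 : ℝ →L[ℝ] ℝ) (deriv ν q₀.1)).comp F₁) q₀ :=
    (hνd q₀.1).hasDerivAt.hasFDerivAt.comp q₀ hasFDerivAt_fst
  have h2 : HasFDerivAt (fun q : ℝ × ℝ × ℝ => q.2.1) F₂ q₀ := F₂.hasFDerivAt
  have h3 : HasFDerivAt (fun q : ℝ × ℝ × ℝ => q.2.2) F₃ q₀ := F₃.hasFDerivAt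
  have hB := h2.fun_smul hN
  have hC := h3.smul_const e₂
  have hΨ' := (hA.fun_add hB).fun_add hC
  set L : ℝ × ℝ × ℝ →L[ℝ] EuclideanSpace ℝ (Fin 3) :=
    (ContinuousLinearMap.smulRight (1 : ℝ →L[ℝ] ℝ) (deriv γ q₀.1)).comp F₁ +
      (q₀.2.1 • (ContinuousLinearMap.smulRight (1 : ℝ →L[ℝ] ℝ) (deriv ν q₀.1)).comp F₁ + F₂.smulRight (ν q₀.1)) + F₃.smulRight e₂ with hL
  have hΨL : HasFDerivAt Ψ L q₀ := hΨ'
  have hLapply : ∀ h : ℝ × ℝ × ℝ, L h = h.1 • deriv γ q₀.1 + (q₀.2.1 • h.1 • deriv ν q₀.1 + h.2.1 • ν q₀.1) + h.2.2 • e₂ := by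
    intro h; simp [hL, hF₁, hF₂, hF₃]
  -- planar coordinates of the data
  have hγ'2 : deriv γ q₀.1 2 = 0 := deriv_apply_two_eq_zero hγd hγ2 q₀.1
  have hν'2 : deriv ν q₀.1 2 = 0 := deriv_apply_two_eq_zero hνd hν2 q₀.1
  -- `L` is injective
  have hinj : Function.Injective L := by
    refine (injective_iff_map_eq_zero L).2 fun h hh => ?_
    rw [hLapply] at hh
    have hc : ∀ i : Fin 3, (h.1 • deriv γ q₀.1 + (q₀.2.1 • h.1 • deriv ν q₀.1 + h.2.1 • ν q₀.1) + h.2.2 • e₂) i = 0 := fun i => by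
      rw [hh]; rfl
    have h3 : h.2.2 = 0 := by
      have := hc 2
      simp [hγ'2, hν'2, hν2, he₂] at this
      exact this
    have h0 := hc 0
    have h1 := hc 1
    simp [he₂] at h0 h1
    -- planar linear algebra
    have hplanar : h.1 • (((deriv γ q₀.1 0 + q₀.2.1 * deriv ν q₀.1 0, deriv γ q₀.1 1 + q₀.2.1 * deriv ν q₀.1 1) : ℝ × ℝ)) +
        h.2.1 • ((ν q₀.1 0, ν q₀.1 1) : ℝ × ℝ) = 0 := by
      ext <;> simp <;> linarith
    obtain ⟨ha, hb⟩ := eq_zero_of_det_ne_zero (by simpa using hdet) hplanar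
    exact Prod.ext ha (Prod.ext hb h3)
  -- hence an equivalence (equal finite dimensions)
  have hdim : Module.finrank ℝ (ℝ × ℝ × ℝ) = Module.finrank ℝ (EuclideanSpace ℝ (Fin 3)) := by
    simp [Module.finrank_prod]
  set Leq : (ℝ × ℝ × ℝ) ≃L[ℝ] EuclideanSpace ℝ (Fin 3) := (LinearMap.linearEquivOfInjective L.toLinearMap hinj hdim).toContinuousLinearEquiv with hLeq
  have hcoe : (Leq : ℝ × ℝ × ℝ →L[ℝ] EuclideanSpace ℝ (Fin 3)) = L := ContinuousLinearMap.ext fun h => rfl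
  -- `Ψ` is `C¹`, so the derivative is strict
  have hΨc1 : ContDiffAt ℝ 1 Ψ q₀ := by
    have hA' : ContDiff ℝ 1 fun q : ℝ × ℝ × ℝ => γ q.1 := hγ1.comp contDiff_fst
    have hN' : ContDiff ℝ 1 fun q : ℝ × ℝ × ℝ => ν q.1 := hν1.comp contDiff_fst
    have h2' : ContDiff ℝ 1 fun q : ℝ × ℝ × ℝ => q.2.1 := contDiff_fst.comp contDiff_snd
    have h3' : ContDiff ℝ 1 fun q : ℝ × ℝ × ℝ => q.2.2 := contDiff_snd.comp contDiff_snd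
    exact ((hA'.add (h2'.smul hN')).add (h3'.smul contDiff_const)).contDiffAt
  have hstrict : HasStrictFDerivAt Ψ (Leq : ℝ × ℝ × ℝ →L[ℝ] EuclideanSpace ℝ (Fin 3)) q₀ := by
    rw [hcoe, ← hΨL.fderiv]
    exact hΨc1.hasStrictFDerivAt one_ne_zero
  exact (hstrict.map_nhds_eq_of_equiv).symm.le

/-- **(U-TUBE) The frame map of a complete unit-speed branch with curvature `≤ B` is open at every point `(s₀, n₀, z₀)` with `|n₀|·B < 1`** (in-plane normal `ν = (−γ′₁, γ′₀, 0)`;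
`det = 1 − n₀·c(s₀)`, `|c| = ‖γ″‖ ≤ B`). -/
theorem nhds_le_map_frame_of_curvature (hγ2c : ContDiff ℝ 2 γ) (hplane : ∀ s, γ s 2 = 0) (hunit : ∀ s, ‖deriv γ s‖ = 1) {B : ℝ}
    (hB : ∀ s, ‖deriv (deriv γ) s‖ ≤ B) (hν : ∀ s, ν s = WithLp.toLp 2 ![-(deriv γ s 1), deriv γ s 0, 0]) (q₀ : ℝ × ℝ × ℝ)
    (hn : |q₀.2.1| * B < 1) :
    𝓝 (γ q₀.1 + q₀.2.1 • ν q₀.1 + q₀.2.2 • EuclideanSpace.single 2 (1 : ℝ)) ≤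
      map (fun q : ℝ × ℝ × ℝ => γ q.1 + q.2.1 • ν q.1 + q.2.2 • EuclideanSpace.single 2 (1 : ℝ)) (𝓝 q₀) := by
  have hγd : Differentiable ℝ γ := hγ2c.differentiable (by norm_num)
  have hγ'd : Differentiable ℝ (deriv γ) := hγ2c.differentiable_deriv_two
  have hνeq : ν = fun s => WithLp.toLp 2 ![-(deriv γ s 1), deriv γ s 0, 0] := funext hν
  -- `ν` is `C¹` with coordinates `(−γ″₁, γ″₀, 0)`
  have hd : ContDiff ℝ 1 (deriv γ) := hγ2c.deriv'
  have hd0 : ContDiff ℝ 1 fun s : ℝ => deriv γ s 0 := (contDiff_piLp_apply (p := 2) (𝕜 := ℝ) (E := fun _ : Fin 3 => ℝ) (i := (0 : Fin 3))).comp hd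
  have hd1 : ContDiff ℝ 1 fun s : ℝ => deriv γ s 1 := (contDiff_piLp_apply (p := 2) (𝕜 := ℝ) (E := fun _ : Fin 3 => ℝ) (i := (1 : Fin 3))).comp hd
  have hν1 : ContDiff ℝ 1 ν := by
    rw [hνeq, contDiff_euclidean]
    intro i
    fin_cases i
    · simpa using hd1.neg
    · simpa using hd0
    · simp; exact contDiff_const
  have hνd : Differentiable ℝ ν := hν1.differentiable one_ne_zero
  have hν2 : ∀ s, ν s 2 = 0 := fun s => by simp [hν s]
  -- coordinates of `ν′`
  have hν'0 : deriv ν q₀.1 0 = -(deriv (deriv γ) q₀.1 1) := by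
    have h1 : HasDerivAt (fun s => ν s 0) (deriv ν q₀.1 0) q₀.1 := hasDerivAt_apply_coord hνd 0 q₀.1
    have h2 : HasDerivAt (fun s => ν s 0) (-(deriv (deriv γ) q₀.1 1)) q₀.1 := by
      have : (fun s => ν s 0) = fun s => -(deriv γ s 1) := by funext s; simp [hν s]
      rw [this]; exact (hasDerivAt_apply_coord hγ'd 1 q₀.1).neg
    exact h1.unique h2
  have hν'1 : deriv ν q₀.1 1 = deriv (deriv γ) q₀.1 0 := by
    have h1 : HasDerivAt (fun s => ν s 1) (deriv ν q₀.1 1) q₀.1 := hasDerivAt_apply_coord hνd 1 q₀.1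
    have h2 : HasDerivAt (fun s => ν s 1) (deriv (deriv γ) q₀.1 0) q₀.1 := by
      have : (fun s => ν s 1) = fun s => deriv γ s 0 := by funext s; simp [hν s]
      rw [this]; exact hasDerivAt_apply_coord hγ'd 0 q₀.1
    exact h1.unique h2
  have hνq0 : ν q₀.1 0 = -(deriv γ q₀.1 1) := by simp [hν q₀.1]
  have hνq1 : ν q₀.1 1 = deriv γ q₀.1 0 := by simp [hν q₀.1]
  -- the determinant `1 − n₀ c`
  set c : ℝ := deriv γ q₀.1 0 * deriv (deriv γ) q₀.1 1 - deriv γ q₀.1 1 * deriv (deriv γ) q₀.1 0 with hc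
  have hsq := sq_add_sq_eq_one_of_unit hγd hplane hunit q₀.1
  have hacc : deriv (deriv γ) q₀.1 = c • WithLp.toLp 2 ![-(deriv γ q₀.1 1), deriv γ q₀.1 0, 0] := by
    rw [hc]; exact deriv_deriv_eq_smul_planeNormal hγ2c hplane hunit q₀.1
  have hnorm1 : ‖(WithLp.toLp 2 ![-(deriv γ q₀.1 1), deriv γ q₀.1 0, 0] : EuclideanSpace ℝ (Fin 3))‖ = 1 :=
    norm_planeNormal_eq_one hγd hplane hunit (ν₃ := fun a => WithLp.toLp 2 ![-(deriv γ a 1), deriv γ a 0, 0]) (fun _ => rfl) q₀.1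
  have hcB : |c| ≤ B := by
    have h := hB q₀.1
    rw [hacc, norm_smul, hnorm1, mul_one, Real.norm_eq_abs] at h
    exact h
  have hdet : (deriv γ q₀.1 0 + q₀.2.1 * deriv ν q₀.1 0) * ν q₀.1 1 - (deriv γ q₀.1 1 + q₀.2.1 * deriv ν q₀.1 1) * ν q₀.1 0 ≠ 0 := by
    have e : (deriv γ q₀.1 0 + q₀.2.1 * deriv ν q₀.1 0) * ν q₀.1 1 - (deriv γ q₀.1 1 + q₀.2.1 * deriv ν q₀.1 1) * ν q₀.1 0 = 1 - q₀.2.1 * c := by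
      rw [hν'0, hν'1, hνq0, hνq1, hc]; linear_combination hsq
    rw [e]
    have h1 : |q₀.2.1 * c| < 1 := by
      rw [abs_mul]
      have hB0 : 0 ≤ B := (norm_nonneg _).trans (hB q₀.1)
      calc |q₀.2.1| * |c| ≤ |q₀.2.1| * B := mul_le_mul_of_nonneg_left hcB (abs_nonneg _)
        _ < 1 := hn
    have := (abs_lt.1 h1).2
    linarith [le_abs_self (q₀.2.1 * c)]
  exact nhds_le_map_frame (hγ2c.of_le (by norm_num)) hν1 hplane hν2 q₀ hdet

end Summit.NavierStokesRegularity.NavierStokesRegularity.Theorems.PoloidalWindowDoorLrcModEntireRidgeFrameOpen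

end
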